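import Mathlib.Data.ZMod.Basic
import Mathlib.Tactic.Ring
import Mathlib.Tactic.Linarith
import Mathlib.Tactic.NormNum
import HarnessLib

/-!
# Venture HSemireg — `2` and `3` are not norms from `ℚ(√−5)`: the infinite descent behind COROLLARY 2 of THEOREM NO-MIX
# («the `±√−5` seed NEVER reaches a coordinate line containing weights `1, 2, 3` together»; ENGINE-W PROBE5 §16) — kernel arithmetic

HONEST FRAMING. Lean index of the computation cell `pub-hsemireg`, widening group ENGINE-W (code A, seat `engine-w-1`,
gen 17). ELEMENTARY NUMBER THEORY (a `5`-adic descent on `x² + 5y² = k·z²`); no abelian variety, sheaf, `Ext` group, secant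
structure or semiregularity map is constructed; nothing here says that HC, HC_CM or HC_AV holds. Theorems only (0 `def`, 0 named
fact, 0 `sorry`). New namespace `SqrtMinusFive`.

SOURCE (the cell's own result): `widen/ENGINE-W/out/probe5/PROBE5-STIZ-A.md` §16 (v2.2, engine-w-1 g6), COROLLARY 1 («reachable ⟺
there are primitive `z₁,…,z₆ ∈ ℤ[√m]` … with `N(z_j)·c_j = T` independent of `j` … In particular every weight RATIO `c_i∕c_j` must lie
in `N(k′^×)` (LAW A at line level, now binding for mixing too)») and **COROLLARY 2** as printed: «(`ℚ(√−5)`, §15 (f) settled). The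
`±√−5` seed NEVER reaches a coordinate line containing weights `1, 2, 3` together (or any two weights with ratio `2, 3, 2∕3, …`):
`2, 3 ∉ N(ℚ(√−5)^×)` (5-adically).» What the kernel holds — the arithmetic fact `2, 3 ∉ N(ℚ(√−5)^×)`, as the absence of integer
solutions of `x² + 5y² = k·z²` with `z ≠ 0` (`N((x + y√−5)∕z) = k`), by the descent «5-adically»: mod 5, `x² ≡ k·z²` with `k = 2, 3` a
non-residue forces `5 ∣ x`, `5 ∣ z`, then `5 ∣ y`, and `(x∕5, y∕5, z∕5)` is a smaller solution:

* §1 `residue_step_two ∕ _three` (`decide` in `ℤ∕5`), **`five_dvd_all`** — any solution of `x² + 5y² = k z²` (`k ∈ {2,3}`) has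
  `5 ∣ x, 5 ∣ y, 5 ∣ z`, and `descend` — then `(x∕5)² + 5(y∕5)² = k(z∕5)²`.
* §2 **`only_zero_solution`** — `x² + 5y² = k·z²`, `k ∈ {2, 3}` ⟹ `x = y = z = 0` (strong induction on `|x| + |y| + |z|`);
  **`two_three_not_norms`** — hence no `x, y, z ∈ ℤ` with `z ≠ 0` and `x² + 5y² = 2z²` or `= 3z²`: `2, 3 ∉ N(ℚ(√−5)^×)`; and
  `two_thirds_is_a_norm` — a PRECISION: `2∕3 = N((1+√−5)∕3)` IS a norm (`6 = N(1+√−5)`), so the card's parenthetical «ratio … 2∕3»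
  is not covered by LAW A alone (the main clause, weights `1, 2, 3` together, is).
WHAT IS NOT HERE: the seed, the lines, THEOREM NO-MIX ∕ CF⁶; the general LAW A.
-/

namespace Summit.Ventures.HSemireg.SqrtMinusFive

/-! ## §1 The residue step and one descent -/

/-- Mod 5: `a² + 5b² = 2c²` forces `a = c = 0` in `ℤ∕5` (`2` is a non-residue). [kernel, `decide`] -/
theorem residue_step_two : ∀ a b c : ZMod 5, a ^ 2 + 5 * b ^ 2 = 2 * c ^ 2 → a = 0 ∧ c = 0 := by
  decide

/-- Mod 5: `a² + 5b² = 3c²` forces `a = c = 0` in `ℤ∕5` (`3` is a non-residue). [kernel, `decide`] -/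
theorem residue_step_three : ∀ a b c : ZMod 5, a ^ 2 + 5 * b ^ 2 = 3 * c ^ 2 → a = 0 ∧ c = 0 := by
  decide

/-- Mod 5: `b² = 0 ⇒ b = 0` in `ℤ∕5`. [kernel, `decide`] -/
theorem residue_sq_zero : ∀ b : ZMod 5, b ^ 2 = 0 → b = 0 := by
  decide

/-- **Every solution is divisible by 5**: `x² + 5y² = k·z²` with `k = 2` or `k = 3` implies `5 ∣ x`, `5 ∣ y` and `5 ∣ z`. [kernel] -/
theorem five_dvd_all (k x y z : ℤ) (hk : k = 2 ∨ k = 3) (h : x ^ 2 + 5 * y ^ 2 = k * z ^ 2) :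
    (5 : ℤ) ∣ x ∧ (5 : ℤ) ∣ y ∧ (5 : ℤ) ∣ z := by
  have h5 := congrArg (fun t : ℤ => (t : ZMod 5)) h
  push_cast at h5
  have hxz : (x : ZMod 5) = 0 ∧ (z : ZMod 5) = 0 := by
    rcases hk with rfl | rfl
    · push_cast at h5; exact residue_step_two _ _ _ h5
    · push_cast at h5; exact residue_step_three _ _ _ h5
  have hx : (5 : ℤ) ∣ x := (ZMod.intCast_zmod_eq_zero_iff_dvd x 5).1 hxz.1
  have hz : (5 : ℤ) ∣ z := (ZMod.intCast_zmod_eq_zero_iff_dvd z 5).1 hxz.2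
  obtain ⟨x₁, rfl⟩ := hx
  obtain ⟨z₁, rfl⟩ := hz
  -- now 5·y² = 25(k z₁² − x₁²), so y² = 5(k z₁² − x₁²) and 5 ∣ y
  have hy2 : y ^ 2 = 5 * (k * z₁ ^ 2 - x₁ ^ 2) := by nlinarith
  have hy5 := congrArg (fun t : ℤ => (t : ZMod 5)) hy2
  push_cast at hy5
  have hy5' : (y : ZMod 5) ^ 2 = 0 := by
    rw [hy5]
    have : (5 : ZMod 5) = 0 := by decide
    rw [this]; ring
  have hy : (5 : ℤ) ∣ y := (ZMod.intCast_zmod_eq_zero_iff_dvd y 5).1 (residue_sq_zero _ hy5')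
  exact ⟨dvd_mul_right 5 x₁, hy, dvd_mul_right 5 z₁⟩

/-- **One descent**: dividing a solution by 5 gives a solution. [kernel] -/
theorem descend (k x₁ y₁ z₁ : ℤ) (h : (5 * x₁) ^ 2 + 5 * (5 * y₁) ^ 2 = k * (5 * z₁) ^ 2) :
    x₁ ^ 2 + 5 * y₁ ^ 2 = k * z₁ ^ 2 := by
  nlinarith

/-! ## §2 Infinite descent: only the zero solution -/

/-- **`x² + 5y² = k·z²` (`k = 2, 3`) has only the zero solution in integers** — strong induction on `|x| + |y| + |z|`. [kernel] -/
theorem only_zero_solution (k : ℤ) (hk : k = 2 ∨ k = 3) :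
    ∀ x y z : ℤ, x ^ 2 + 5 * y ^ 2 = k * z ^ 2 → x = 0 ∧ y = 0 ∧ z = 0 := by
  suffices H : ∀ n : ℕ, ∀ x y z : ℤ, x.natAbs + y.natAbs + z.natAbs ≤ n →
      x ^ 2 + 5 * y ^ 2 = k * z ^ 2 → x = 0 ∧ y = 0 ∧ z = 0 by
    intro x y z h; exact H _ x y z le_rfl h
  intro n
  induction n using Nat.strong_induction_on with
  | _ n ih =>
    intro x y z hn h
    obtain ⟨⟨x₁, rfl⟩, ⟨y₁, rfl⟩, ⟨z₁, rfl⟩⟩ := five_dvd_all k x y z hk h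
    have h' := descend k x₁ y₁ z₁ h
    by_cases h0 : x₁ = 0 ∧ y₁ = 0 ∧ z₁ = 0
    · obtain ⟨rfl, rfl, rfl⟩ := h0; simp
    · -- the smaller solution has strictly smaller measure
      have hmeas : x₁.natAbs + y₁.natAbs + z₁.natAbs < n := by
        have e1 : (5 * x₁).natAbs = 5 * x₁.natAbs := by rw [Int.natAbs_mul]; rfl
        have e2 : (5 * y₁).natAbs = 5 * y₁.natAbs := by rw [Int.natAbs_mul]; rfl
        have e3 : (5 * z₁).natAbs = 5 * z₁.natAbs := by rw [Int.natAbs_mul]; rfl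
        rw [e1, e2, e3] at hn
        have hpos : 0 < x₁.natAbs + y₁.natAbs + z₁.natAbs := by
          by_contra hle
          push Not at hle
          have : x₁.natAbs = 0 ∧ y₁.natAbs = 0 ∧ z₁.natAbs = 0 := by omega
          exact h0 ⟨Int.natAbs_eq_zero.1 this.1, Int.natAbs_eq_zero.1 this.2.1, Int.natAbs_eq_zero.1 this.2.2⟩
        omega
      obtain ⟨hx, hy, hz⟩ := ih _ hmeas x₁ y₁ z₁ le_rfl h'
      exact absurd ⟨hx, hy, hz⟩ h0

/-- **`2, 3 ∉ N(ℚ(√−5)^×)`**: there are no integers `x, y, z` with `z ≠ 0` and `x² + 5y² = 2z²` (resp. `= 3z²`) — i.e. no element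
`(x + y√−5)∕z` of `ℚ(√−5)` has norm `2` (resp. `3`). [kernel] -/
theorem two_three_not_norms (x y z : ℤ) (hz : z ≠ 0) :
    x ^ 2 + 5 * y ^ 2 ≠ 2 * z ^ 2 ∧ x ^ 2 + 5 * y ^ 2 ≠ 3 * z ^ 2 := by
  constructor
  · intro h; exact hz (only_zero_solution 2 (Or.inl rfl) x y z h).2.2
  · intro h; exact hz (only_zero_solution 3 (Or.inr rfl) x y z h).2.2

/-- **PRECISION to the printed parenthetical «(or any two weights with ratio 2, 3, 2∕3, …)»**: the ratio `2∕3` IS a norm from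
`ℚ(√−5)` — `6 = N(1 + √−5) = 1² + 5·1²`, so `2∕3 = 6∕9 = N((1 + √−5)∕3)`; LAW A therefore excludes two weights of ratio `2` or `3`
(by `two_three_not_norms`) but NOT of ratio `2∕3` by itself. The main clause of COROLLARY 2 (weights `1, 2, 3` together) only uses
`2, 3 ∉ N`. [kernel, `norm_num`] -/
theorem two_thirds_is_a_norm : (1 : ℤ) ^ 2 + 5 * 1 ^ 2 = 6 * 1 ^ 2 ∧ ((1 : ℚ) ^ 2 + 5 * 1 ^ 2) / 3 ^ 2 = 2 / 3 := by
  refine ⟨by norm_num, by norm_num⟩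

end Summit.Ventures.HSemireg.SqrtMinusFive
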